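import Summits.FinalStateConjecture.FinalStateConjecture.Theorems.ClusterCompletenessAdiabaticMultiKerrILEDMorawetzBulkLower
import Summits.FinalStateConjecture.FinalStateConjecture.Theorems.ClusterCompletenessAdiabaticMultiKerrILEDMorawetzTotalCurrent
import Summits.FinalStateConjecture.FinalStateConjecture.Theorems.ClusterCompletenessAdiabaticMultiKerrILEDMorawetzCurrentRegularity
import Summits.FinalStateConjecture.FinalStateConjecture.Theorems.ClusterCompletenessAdiabaticMultiKerrILEDMorawetzHorizonLayer
import Summits.FinalStateConjecture.FinalStateConjecture.Theorems.ClusterCompletenessAdiabaticMultiKerrILEDMorawetzStaticLayer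
import Summits.FinalStateConjecture.FinalStateConjecture.Theorems.ClusterCompletenessAdiabaticMultiKerrILEDMorawetzLeafFlux
import Summits.FinalStateConjecture.FinalStateConjecture.Theorems.ClusterCompletenessAdiabaticMultiKerrILEDLeafHardyExterior
import Summits.FinalStateConjecture.FinalStateConjecture.Theorems.ClusterCompletenessAdiabaticMultiKerrILEDSlabWeightedExhaustion
import Summits.FinalStateConjecture.FinalStateConjecture.Theorems.ClusterCompletenessAdiabaticMultiKerrILEDRestFrameFarEnergyBound
import Summits.FinalStateConjecture.FinalStateConjecture.Theorems.ClusterCompletenessAdiabaticMultiKerrILEDRestFrameDegenerateILEDWeighted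
import Literature.Geometry.Lorentzian.KerrSliceHardy
import Literature.Geometry.Lorentzian.KerrWaveEnergyProofs

/-!
# Route ClusterCompleteness — crux `AdiabaticMultiKerrILED`, line `Sketch`:
# the degenerate integrated local energy decay estimate of the tails-cut zero-spin zone (rest frame)

Helper file for the crux `stmt-FinalStateConjecture-14310`
(`Summit.FinalStateConjecture.FinalStateConjecture.Theses.ClusterCompleteness.AdiabaticMultiKerrILED`),
line `Sketch`, stub `restFrame_degenerateILED_zeroSpin` (lead c7, wave 6: the assembly of the
degenerate Morawetz estimate from the wave-5 bricks). Setting (one zone, zero spin, rest frame):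
`G₀ = KerrSchild.inverseMetric φ (Kerr.nullVector 0)`, `φ = χ(2 − r/(8M)) · 2H`
(`χ = Real.smoothTransition`, `r = Kerr.radius 0 = ‖x⃗‖`), the total Morawetz current
`J = J^X + ¼ L^{ϖ₂} + J_H + J^T` of a `C²` solution `Φ` of `□_{G₀}Φ = 0` on `{F(x⃗) ≤ x⁰} ∩ {r > 2M}`,
the tilted leaves `{x⁰ = u + F(x⃗)}` (`F ∈ C²`, `‖∇F‖ ≤ ½`), and the designed good bulk
`𝔅 = (r−2M)M³(r−3M)²/(2r⁷)(∂₀Φ)² + 3M/(20r²)(∂_{r*}Φ)² + (r−3M)²/(8r³)|∇̸Φ|² + 𝟙_{r≥7M}M(r−7M)/(4r⁵)Φ²`.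

* `degILED_bulk_nonneg` — `𝔅 ≥ 0` on `{r > 2M}`;
* `degILED_leaf_bound` — `∫_{2M<‖y‖}(∑(∂Φ)² + Φ²/‖y‖²) ≤ (1 + 2C_H)∫_{2M<‖y‖}∑(∂Φ)²` along a leaf
  (Hardy inequality `leaf_hardy_exterior` for `u = Φ(t + F(·), ·)`, `‖∇u‖² ≤ 2∑(∂Φ)²`);
* `restFrame_degenerateILED_zeroSpin` — **the registered stub**: the bricks
  `contDiffAt_morawetzTotalCurrent`, `contDiff_weightedMorawetzCurrent`, `morawetz_totalBulk_lower` +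
  `sum_fderiv_morawetzTotalCurrent` (`𝔅 ≤ ∑∂J`), `morawetz_horizonLayer_lower`,
  `morawetz_leafFlux_abs_le`, `morawetz_staticLayer_abs_le` feed `degILED_weighted_le` with
  `Λ = (1 + 2C_H)(1 + C_E)E(0)`; then `slab_lintegral_le_of_weighted_le` (`ε → 0`), `R → ∞`, and
  `degILED_exhaustion` (`s → ∞`): `∫_{u>0} ∫_{r>2M} 𝔅 ≤ C(1 + C_E)E(0)`, `C = 2(K_f + 1)(1 + 2C_H)`.

Dafermos–Rodnianski arXiv:0811.0354, §4.1 (the degenerate `X`-estimate with Hardy correction);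
Dafermos–Rodnianski–Shlapentokh-Rothman arXiv:1402.7034, §2.3.2, §13.2. [folklore]
-/

noncomputable section

-- the doubled `FinalStateConjecture.FinalStateConjecture` path component trips dupNamespace
set_option linter.dupNamespace false

open Set Filter Metric MeasureTheory
open scoped BigOperators Topology ENNReal
open Literature.Geometry.Lorentzian

namespace Summit.FinalStateConjecture.FinalStateConjecture.Theorems

/-! ### The good bulk and the leaf quantities -/

/-- **The good bulk is non-negative on `{r > 2M}`**: every coefficient of
`𝔅 = (r−2M)M³(r−3M)²/(2r⁷)(∂₀Φ)² + 3M/(20r²)(∂_{r*}Φ)² + (r−3M)²/(8r³)|∇̸Φ|² + 𝟙_{r≥7M}M(r−7M)/(4r⁵)Φ²`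
is `≥ 0` there, and `|∇̸Φ|² = ∑(∂ᵢΦ)² − (x⃗·∇Φ/r)² ≥ 0` by Cauchy–Schwarz. [folklore] -/
theorem degILED_bulk_nonneg {M : ℝ} (hM : 0 < M) (Φ : E4 → ℝ) {x : E4}
    (hx : 2 * M < Kerr.radius 0 x) :
    0 ≤ ((Kerr.radius 0 x - 2 * M) * M ^ 3 * (Kerr.radius 0 x - 3 * M) ^ 2 /
        (2 * Kerr.radius 0 x ^ 7)) * fderiv ℝ Φ x (E4.basisVector 0) ^ 2 +
      (3 * M / (20 * Kerr.radius 0 x ^ 2)) *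
        ((1 - (Real.smoothTransition (2 - Kerr.radius 0 x / (8 * M)) * (2 * Kerr.scalarH M 0 x))) *
            (∑ i : Fin 3, x i.succ * fderiv ℝ Φ x (E4.basisVector i.succ)) / Kerr.radius 0 x +
          (Real.smoothTransition (2 - Kerr.radius 0 x / (8 * M)) * (2 * Kerr.scalarH M 0 x)) *
            fderiv ℝ Φ x (E4.basisVector 0)) ^ 2 +
      ((Kerr.radius 0 x - 3 * M) ^ 2 / (8 * Kerr.radius 0 x ^ 3)) *
        ((∑ i : Fin 3, fderiv ℝ Φ x (E4.basisVector i.succ) ^ 2) -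
          ((∑ i : Fin 3, x i.succ * fderiv ℝ Φ x (E4.basisVector i.succ)) / Kerr.radius 0 x) ^ 2) +
      (if 7 * M ≤ Kerr.radius 0 x then M * (Kerr.radius 0 x - 7 * M) / (4 * Kerr.radius 0 x ^ 5)
        else 0) * Φ x ^ 2 := by
  have hr : 0 < Kerr.radius 0 x := lt_trans (by positivity) hx
  have h2 : 0 ≤ Kerr.radius 0 x - 2 * M := by linarith
  have hg : 0 ≤ (∑ i : Fin 3, fderiv ℝ Φ x (E4.basisVector i.succ) ^ 2) -
      ((∑ i : Fin 3, x i.succ * fderiv ℝ Φ x (E4.basisVector i.succ)) / Kerr.radius 0 x) ^ 2 := by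
    rw [sub_nonneg, div_pow, div_le_iff₀ (by positivity), Kerr.radius_zero_left, E4.spatialNorm_sq]
    simp only [Fin.sum_univ_three, Fin.succ_zero_eq_one, Fin.succ_one_eq_two,
      Kerr.fin_succ_two_eq_three]
    nlinarith [sq_nonneg (x 1 * fderiv ℝ Φ x (E4.basisVector 2) - x 2 * fderiv ℝ Φ x (E4.basisVector 1)),
      sq_nonneg (x 1 * fderiv ℝ Φ x (E4.basisVector 3) - x 3 * fderiv ℝ Φ x (E4.basisVector 1)),
      sq_nonneg (x 2 * fderiv ℝ Φ x (E4.basisVector 3) - x 3 * fderiv ℝ Φ x (E4.basisVector 2))]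
  have h4 : 0 ≤ (if 7 * M ≤ Kerr.radius 0 x then
      M * (Kerr.radius 0 x - 7 * M) / (4 * Kerr.radius 0 x ^ 5) else 0) := by
    split_ifs with h7
    · have : 0 ≤ Kerr.radius 0 x - 7 * M := by linarith
      positivity
    · exact le_rfl
  refine add_nonneg (add_nonneg (add_nonneg (mul_nonneg (div_nonneg (mul_nonneg (mul_nonneg h2
    (by positivity)) (sq_nonneg _)) (by positivity)) (sq_nonneg _)) (by positivity))
    (mul_nonneg (by positivity) hg)) (mul_nonneg h4 (sq_nonneg _))

/-- **The zeroth-order leaf term is controlled by the leaf energy.** With the Hardy inequality on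
`{‖y‖ > 2M}` (constant `C_H`, hypothesis `hHardy` = `leaf_hardy_exterior`), for `F, Φ ∈ C²`,
`‖∇F‖ ≤ ½` and a leaf `t` with Hardy decay of `u = Φ(t + F(·), ·)`:
`∫_{2M<‖y‖} (∑(∂Φ)² + Φ²/‖y‖²) ≤ (1 + 2C_H) ∫_{2M<‖y‖} ∑(∂Φ)²` along the leaf, since
`∇u = (∂ᵢΦ + ∂ᵢF ∂₀Φ)ᵢ` (`Kerr.fderiv_comp_graphMap`) has `‖∇u‖² ≤ 2∑_μ(∂_μΦ)²`
(`∑(∂ᵢF)² ≤ ¼`). [folklore] -/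
theorem degILED_leaf_bound {M : ℝ} {CH : NNReal} {F : E3 → ℝ} {Φ : E4 → ℝ}
    (hHardy : ∀ (u : E3 → ℝ), (∀ y : E3, 2 * M < ‖y‖ → ContDiffAt ℝ 1 u y) →
      (∃ ρ₀ : ℝ, ∫⁻ y in {y : E3 | ρ₀ < ‖y‖}, ENNReal.ofReal (u y ^ 2 / ‖y‖ ^ 2) < ⊤) →
      ∫⁻ y in {y : E3 | 2 * M < ‖y‖}, ENNReal.ofReal (u y ^ 2 / ‖y‖ ^ 2) ≤
        (CH : ℝ≥0∞) * ∫⁻ y in {y : E3 | 2 * M < ‖y‖}, ENNReal.ofReal (‖fderiv ℝ u y‖ ^ 2))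
    (hF : ContDiff ℝ 2 F) (hslope : ∀ y, ‖fderiv ℝ F y‖ ≤ 2⁻¹) (hΦ : ContDiff ℝ 2 Φ) {t : ℝ}
    (hdec : ∃ ρ₀ : ℝ, ∫⁻ y in {y : E3 | ρ₀ < ‖y‖},
      ENNReal.ofReal (Φ (E4.ofTimeSpace (t + F y) y) ^ 2 / ‖y‖ ^ 2) < ⊤) :
    ∫⁻ y in {y : E3 | 2 * M < ‖y‖}, ENNReal.ofReal
        (∑ μ, fderiv ℝ Φ (E4.ofTimeSpace (t + F y) y) (E4.basisVector μ) ^ 2 +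
          Φ (E4.ofTimeSpace (t + F y) y) ^ 2 / ‖y‖ ^ 2) ≤
      (1 + 2 * (CH : ℝ≥0∞)) * ∫⁻ y in {y : E3 | 2 * M < ‖y‖}, ENNReal.ofReal
        (∑ μ, fderiv ℝ Φ (E4.ofTimeSpace (t + F y) y) (E4.basisVector μ) ^ 2) := by
  set u : E3 → ℝ := fun y ↦ Φ (E4.ofTimeSpace (t + F y) y) with hu
  set D : E3 → ℝ := fun y ↦ ∑ μ, fderiv ℝ Φ (E4.ofTimeSpace (t + F y) y) (E4.basisVector μ) ^ 2
    with hD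
  have hu2 : ContDiff ℝ 2 u := hΦ.comp (Kerr.contDiff_graphMap hF t)
  have hgrad : ∀ y, ‖fderiv ℝ u y‖ ^ 2 ≤ 2 * D y := by
    intro y
    have hFy : DifferentiableAt ℝ F y := hF.differentiable (by simp) y
    have hΦy : DifferentiableAt ℝ Φ (E4.ofTimeSpace (t + F y) y) := hΦ.differentiable (by simp) _
    have hc : ∑ i, Kerr.partialE3 F y i ^ 2 ≤ 4⁻¹ :=
      (Kerr.sum_sq_partialE3_le F y).trans (by nlinarith [hslope y, norm_nonneg (fderiv ℝ F y)])
    obtain ⟨p, hp⟩ : ∃ p : Fin 4 → ℝ, ∀ μ,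
        fderiv ℝ Φ (E4.ofTimeSpace (t + F y) y) (E4.basisVector μ) = p μ := ⟨_, fun _ ↦ rfl⟩
    obtain ⟨c, hc'⟩ : ∃ c : Fin 3 → ℝ, ∀ i, Kerr.partialE3 F y i = c i := ⟨_, fun _ ↦ rfl⟩
    rw [norm_sq_eq_sum_sq_apply_single]
    simp only [hu, hD, Kerr.fderiv_comp_graphMap hFy t hΦy, hp, hc', Fin.sum_univ_four,
      Fin.sum_univ_three, Fin.succ_zero_eq_one, Fin.succ_one_eq_two,
      Kerr.fin_succ_two_eq_three] at hc ⊢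
    nlinarith [sq_nonneg (c 0 * p 0 - p 1), sq_nonneg (c 1 * p 0 - p 2),
      sq_nonneg (c 2 * p 0 - p 3), mul_le_mul_of_nonneg_left hc (sq_nonneg (p 0))]
  have hDm : Measurable fun y ↦ ENNReal.ofReal (D y) :=
    Kerr.measurable_sum_sq_fderiv_graph Φ hF.continuous t
  have hD0 : ∀ y, 0 ≤ D y := fun y ↦ Finset.sum_nonneg fun μ _ ↦ sq_nonneg _
  have h1 := hHardy u (fun y _ ↦ hu2.contDiffAt.of_le one_le_two) hdec
  have h2 : ∫⁻ y in {y : E3 | 2 * M < ‖y‖}, ENNReal.ofReal (‖fderiv ℝ u y‖ ^ 2) ≤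
      2 * ∫⁻ y in {y : E3 | 2 * M < ‖y‖}, ENNReal.ofReal (D y) := by
    rw [← lintegral_const_mul 2 hDm]
    refine lintegral_mono fun y ↦ (ENNReal.ofReal_le_ofReal (hgrad y)).trans_eq ?_
    rw [ENNReal.ofReal_mul zero_le_two, ENNReal.ofReal_ofNat]
  calc ∫⁻ y in {y : E3 | 2 * M < ‖y‖}, ENNReal.ofReal (D y + u y ^ 2 / ‖y‖ ^ 2)
      = ∫⁻ y in {y : E3 | 2 * M < ‖y‖}, (ENNReal.ofReal (D y) + ENNReal.ofReal (u y ^ 2 / ‖y‖ ^ 2)) :=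
        lintegral_congr fun y ↦ ENNReal.ofReal_add (hD0 y) (by positivity)
    _ = (∫⁻ y in {y : E3 | 2 * M < ‖y‖}, ENNReal.ofReal (D y)) +
          ∫⁻ y in {y : E3 | 2 * M < ‖y‖}, ENNReal.ofReal (u y ^ 2 / ‖y‖ ^ 2) :=
        lintegral_add_left hDm _
    _ ≤ (∫⁻ y in {y : E3 | 2 * M < ‖y‖}, ENNReal.ofReal (D y)) +
          CH * (2 * ∫⁻ y in {y : E3 | 2 * M < ‖y‖}, ENNReal.ofReal (D y)) :=
        add_le_add le_rfl (h1.trans (mul_le_mul_of_nonneg_left h2 bot_le))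
    _ = (1 + 2 * (CH : ℝ≥0∞)) * ∫⁻ y in {y : E3 | 2 * M < ‖y‖}, ENNReal.ofReal (D y) := by ring

/-! ### The registered stub -/

/-- **The degenerate integrated local energy decay estimate of the static tails-cut Schwarzschild
zone, rest frame, zero spin** (crux `stmt-FinalStateConjecture-14310`, line `Sketch`, stub
`restFrame_degenerateILED_zeroSpin`). For `M > 0` there is `C` such that for every `C²` height `F`
of slope `≤ ½`, every `C²` solution `Φ` of `□_{G₀}Φ = 0` on `{F(x⃗) ≤ x⁰} ∩ {r > 2M}` whose leaf
functions decay in the Hardy sense (`hH`) and whose exterior leaf energies are bounded by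
`C_E E(0)` (`hE`), the space-time integral over `{u > 0} × {r > 2M}` (leaf parametrisation
`(u + F(y), y)`) of the degenerate density
`𝔅 = (r−2M)M³(r−3M)²/(2r⁷)(∂₀Φ)² + 3M/(20r²)(∂_{r*}Φ)² + (r−3M)²/(8r³)|∇̸Φ|² + 𝟙_{r≥7M}M(r−7M)/(4r⁵)Φ²`
is at most `C(1 + C_E)E(0)`, `E(0) = ∫_{leaf 0 ∩ {r>2M}} ∑_μ(∂_μΦ)²` (`[0, ∞]`-valued; degenerate
at the photon sphere `r = 3M` and at the horizon). Assembly: the pointwise bricks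
`morawetz_totalBulk_lower`/`sum_fderiv_morawetzTotalCurrent` (`𝔅 ≤ ∑∂J`),
`contDiff(At)_…MorawetzCurrent`, `morawetz_horizonLayer_lower`, `morawetz_leafFlux_abs_le`,
`morawetz_staticLayer_abs_le` feed `degILED_weighted_le` with `Λ = (1 + 2C_H)(1 + C_E)E(0)`
(`degILED_leaf_bound` with `leaf_hardy_exterior`, `degILED_abs_integral_le`); then
`slab_lintegral_le_of_weighted_le` (`ε → 0`), `R → ∞`, and `degILED_exhaustion`
(`s → ∞`); `C = 2(K_f + 1)(1 + 2C_H)`. Dafermos–Rodnianski arXiv:0811.0354, §4.1;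
Dafermos–Rodnianski–Shlapentokh-Rothman arXiv:1402.7034, §2.3.2, §13.2. [folklore] -/
theorem restFrame_degenerateILED_zeroSpin : ∀ (M : ℝ), 0 < M → ∃ C : NNReal, ∀ (F : E3 → ℝ) (Φ : E4 → ℝ) (CE : NNReal), let B : E4 → ℝ := fun x ↦ (((Kerr.radius 0 x - 2 * M) * M ^ 3 * (Kerr.radius 0 x - 3 * M) ^ 2 / (2 * Kerr.radius 0 x ^ 7)) * fderiv ℝ Φ x (E4.basisVector 0) ^ 2 + (3 * M / (20 * Kerr.radius 0 x ^ 2)) * ((1 - (Real.smoothTransition (2 - Kerr.radius 0 x / (8 * M)) * (2 * Kerr.scalarH M 0 x))) * (∑ i : Fin 3, x i.succ * fderiv ℝ Φ x (E4.basisVector i.succ)) / Kerr.radius 0 x + (Real.smoothTransition (2 - Kerr.radius 0 x / (8 * M)) * (2 * Kerr.scalarH M 0 x)) * fderiv ℝ Φ x (E4.basisVector 0)) ^ 2 + ((Kerr.radius 0 x - 3 * M) ^ 2 / (8 * Kerr.radius 0 x ^ 3)) * ((∑ i : Fin 3, fderiv ℝ Φ x (E4.basisVector i.succ) ^ 2)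 - ((∑ i : Fin 3, x i.succ * fderiv ℝ Φ x (E4.basisVector i.succ)) / Kerr.radius 0 x) ^ 2) + (if 7 * M ≤ Kerr.radius 0 x then M * (Kerr.radius 0 x - 7 * M) / (4 * Kerr.radius 0 x ^ 5) else 0) * Φ x ^ 2); ContDiff ℝ 2 F → (∀ y, ‖fderiv ℝ F y‖ ≤ 2⁻¹) → ContDiff ℝ 2 Φ → (∀ x : E4, F (E4.spatial x) ≤ x 0 → 2 * M < Kerr.radius 0 x → KerrSchild.waveOperator (KerrSchild.inverseMetric (fun y ↦ Real.smoothTransition (2 - Kerr.radius 0 y / (8 * M)) * (2 * Kerr.scalarH M 0 y)) (Kerr.nullVector 0)) Φ x = 0) → (∀ s : ℝ, 0 ≤ s → ∃ ρ₀ : ℝ, ∫⁻ y in {y : E3 | ρ₀ < ‖y‖}, ENNReal.ofReal (Φ (E4.ofTimeSpace (s + F y) y) ^ 2 / ‖y‖ ^ 2) < ⊤) → (∀ s : ℝ, 0 ≤ s → ∫⁻ y in {y : E3 | 2 * M < ‖y‖}, ENNReal.ofReal (∑ μ : Fin 4, fderiv ℝ Φ (E4.ofTimeSpace (s + F y) y)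 (E4.basisVector μ) ^ 2) ≤ (CE : ENNReal) * ∫⁻ y in {y : E3 | 2 * M < ‖y‖}, ENNReal.ofReal (∑ μ : Fin 4, fderiv ℝ Φ (E4.ofTimeSpace (0 + F y) y) (E4.basisVector μ) ^ 2)) → ∫⁻ u in Set.Ioi (0 : ℝ), ∫⁻ y in {y : E3 | 2 * M < ‖y‖}, ENNReal.ofReal (B (E4.ofTimeSpace (u + F y) y)) ≤ (C : ENNReal) * (1 + (CE : ENNReal)) * ∫⁻ y in {y : E3 | 2 * M < ‖y‖}, ENNReal.ofReal (∑ μ : Fin 4, fderiv ℝ Φ (E4.ofTimeSpace (0 + F y) y) (E4.basisVector μ) ^ 2) := by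
  intro M hM
  -- ### the constants of the bricks
  obtain ⟨Kf, hKf0, hflux⟩ := morawetz_leafFlux_abs_le M hM
  obtain ⟨CH, hHardy⟩ := leaf_hardy_exterior M hM
  obtain ⟨Kh, hKh0, hhor⟩ := morawetz_horizonLayer_lower M hM
  obtain ⟨KR, hKR0, hstat⟩ := morawetz_staticLayer_abs_le M hM
  refine ⟨(2 * (Kf + 1)).toNNReal * (1 + 2 * CH), ?_⟩
  intro F Φ CE B hF hslope hΦ hsol hH hE
  set S : Set E3 := {y : E3 | 2 * M < ‖y‖} with hS
  set E0 : ℝ≥0∞ := ∫⁻ y in S, ENNReal.ofReal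
    (∑ μ : Fin 4, fderiv ℝ Φ (E4.ofTimeSpace (0 + F y) y) (E4.basisVector μ) ^ 2) with hE0
  have hSm : MeasurableSet S := (isOpen_lt continuous_const continuous_norm).measurableSet
  have hcoe : (((2 * (Kf + 1)).toNNReal * (1 + 2 * CH) : NNReal) : ℝ≥0∞) =
      ENNReal.ofReal (2 * (Kf + 1)) * (1 + 2 * (CH : ℝ≥0∞)) := by
    rw [ENNReal.coe_mul, ENNReal.coe_add, ENNReal.coe_mul, ENNReal.coe_one, ENNReal.coe_ofNat]
    rfl
  rw [hcoe]
  -- ### the case of infinite initial energy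
  rcases eq_or_ne E0 ⊤ with hE0top | hE0top
  · rw [hE0top, ENNReal.mul_top]
    · exact le_top
    · refine mul_ne_zero (mul_ne_zero ?_ ?_) ?_
      · exact (ENNReal.ofReal_pos.2 (by positivity)).ne'
      · exact (add_pos_of_pos_of_nonneg one_pos bot_le).ne'
      · exact (add_pos_of_pos_of_nonneg one_pos bot_le).ne'
  -- ### the uniform bound `Λ` of the leaf quantities
  set Λ : ℝ≥0∞ := (1 + 2 * (CH : ℝ≥0∞)) * ((1 + (CE : ℝ≥0∞)) * E0) with hΛ
  have hΛtop : Λ ≠ ⊤ :=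
    ENNReal.mul_ne_top (ENNReal.add_ne_top.2 ⟨ENNReal.one_ne_top, ENNReal.mul_ne_top (by norm_num)
      ENNReal.coe_ne_top⟩) (ENNReal.mul_ne_top (by simp) hE0top)
  have hV : ∀ t : ℝ, 0 ≤ t → ∫⁻ y in S, ENNReal.ofReal
      (∑ μ, fderiv ℝ Φ (E4.ofTimeSpace (t + F y) y) (E4.basisVector μ) ^ 2 +
        Φ (E4.ofTimeSpace (t + F y) y) ^ 2 / ‖y‖ ^ 2) ≤ Λ := fun t ht ↦
    (degILED_leaf_bound hHardy hF hslope hΦ (hH t ht)).trans (mul_le_mul_of_nonneg_left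
      ((hE t ht).trans (mul_le_mul_of_nonneg_right le_add_self bot_le)) bot_le)
  have hVfin : ∀ t : ℝ, 0 ≤ t → ∫⁻ y in S, ENNReal.ofReal
      (∑ μ, fderiv ℝ Φ (E4.ofTimeSpace (t + F y) y) (E4.basisVector μ) ^ 2 +
        Φ (E4.ofTimeSpace (t + F y) y) ^ 2 / ‖y‖ ^ 2) ≠ ⊤ := fun t ht ↦
    ((hV t ht).trans_lt (lt_top_iff_ne_top.2 hΛtop)).ne
  have hLrad : ∀ (t : ℝ) (y : E3), Kerr.radius 0 (E4.ofTimeSpace (t + F y) y) = ‖y‖ := fun t y ↦ by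
    rw [Kerr.radius_zero_left, E4.spatialNorm_ofTimeSpace]
  -- ### the weighted slab inequality, from the bricks
  have hmain : ∀ (s R : ℝ), 0 ≤ s → 16 * M ≤ R → ∀ ε : ℝ, 0 < ε →
      16 * ε * Real.exp ((s + |F 0| + 2 * R) / (2 * M)) ≤ M →
      ∫ u in Ioc 0 s, ∫ y : E3,
        (Real.smoothTransition (Kerr.horizonFn M 0 (E4.ofTimeSpace (u + F y) y) / ε - 1) *
            Real.smoothTransition (2 - E4.spatialNorm (E4.ofTimeSpace (u + F y) y) ^ 2 / R ^ 2)) *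
          B (E4.ofTimeSpace (u + F y) y) ≤
        2 * ((Kf + 1) * Λ.toReal) + s * (KR / R * Λ.toReal) := by
    intro s R hs hR ε hε hεT
    have hRpos : 0 < R := lt_of_lt_of_le (by positivity) hR
    refine degILED_weighted_le (Kf := Kf + 1) (KR := KR) (Λr := Λ.toReal) hM hε hR hs hKh0 hεT hF
      hslope hΦ (fun x hx μ ↦ contDiffAt_morawetzTotalCurrent M Φ x hM hx hΦ.contDiffAt μ)
      (fun ε' hε' μ ↦ contDiff_weightedMorawetzCurrent M ε' R Φ hM hε' hRpos hΦ μ)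
      (fun x hx ↦ continuousAt_morawetzBulk hM hΦ (lt_trans (by positivity) hx))
      (fun x hx ↦ degILED_bulk_nonneg hM Φ hx)
      (fun x h1 hx ↦ (morawetz_totalBulk_lower M Φ x hM hx).trans_eq
        (sum_fderiv_morawetzTotalCurrent M Φ x hM hx hΦ.contDiffAt (hsol x h1 hx)).symm)
      (fun ε' x hε' hx h3 ↦ hhor ε' Φ x hε' hx h3) (fun ε' t hε' ht ↦ ?_) (fun ε' u hε' hu ↦ ?_)
    · -- the weighted leaf flux
      refine (degILED_abs_integral_le hSm (by positivity) (fun y ↦ ?_) (hVfin t ht)).trans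
        (mul_le_mul_of_nonneg_left (ENNReal.toReal_mono hΛtop (hV t ht)) (by positivity))
      by_cases hyS : y ∈ S
      · have hr : 2 * M < Kerr.radius 0 (E4.ofTimeSpace (t + F y) y) := by
          rw [hLrad]
          exact hyS
        rw [indicator_of_mem hyS, abs_mul, abs_neg]
        have h1 : |Real.smoothTransition (Kerr.horizonFn M 0 (E4.ofTimeSpace (t + F y) y) / ε' - 1) *
            Real.smoothTransition (2 - E4.spatialNorm (E4.ofTimeSpace (t + F y) y) ^ 2 / R ^ 2)| ≤ 1 := by
          rw [abs_of_nonneg (mul_nonneg (Real.smoothTransition.nonneg _)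
            (Real.smoothTransition.nonneg _))]
          exact mul_le_one₀ (Real.smoothTransition.le_one _) (Real.smoothTransition.nonneg _)
            (Real.smoothTransition.le_one _)
        have h2 := hflux Φ (E4.ofTimeSpace (t + F y) y) (Kerr.graphConormal F y) hr
          (Kerr.graphConormal_zero F y) (restFrame_graphConormal_sq_le hslope y)
        refine (mul_le_mul h1 h2 (abs_nonneg _) zero_le_one).trans ?_
        rw [one_mul, hLrad]
        have hq : (0 : ℝ) ≤ ∑ μ, fderiv ℝ Φ (E4.ofTimeSpace (t + F y) y) (E4.basisVector μ) ^ 2 +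
            Φ (E4.ofTimeSpace (t + F y) y) ^ 2 / ‖y‖ ^ 2 := by positivity
        nlinarith [hq]
      · have hu0 : Kerr.horizonFn M 0 (E4.ofTimeSpace (t + F y) y) ≤ 0 := by
          unfold Kerr.horizonFn
          rw [Kerr.rPlus_zero_right hM.le, hLrad]
          have hy2 : ¬2 * M < ‖y‖ := fun h ↦ hyS h
          exact mul_nonpos_iff.mpr (Or.inr ⟨by linarith [not_lt.mp hy2], (Real.exp_pos _).le⟩)
        rw [indicator_of_notMem hyS, tailsCutWeight_eq_zero_of_horizonFn_lt hε' (hu0.trans_lt hε'),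
          zero_mul, abs_zero]
    · -- the static layer
      refine (le_abs_self _).trans ((degILED_abs_integral_le hSm (by positivity) (fun y ↦ ?_)
        (hVfin u hu)).trans (mul_le_mul_of_nonneg_left (ENNReal.toReal_mono hΛtop (hV u hu))
        (by positivity)))
      rw [abs_of_nonneg (mul_nonneg (Real.smoothTransition.nonneg _) (abs_nonneg _))]
      by_cases hyR : ‖y‖ < R
      · have h0 := degILED_fderiv_staticCutoff_eq_zero hRpos (x := E4.ofTimeSpace (u + F y) y)
          (Or.inl (by rw [E4.spatialNorm_ofTimeSpace]; gcongr))
        have h00 : ∀ μ, (0 : E4 →L[ℝ] ℝ) (E4.basisVector μ) = 0 := fun μ ↦ rfl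
        simp only [h0, h00, zero_mul, Finset.sum_const_zero, abs_zero, mul_zero]
        exact indicator_nonneg (fun y _ ↦ by positivity) _
      · rw [not_lt] at hyR
        have hyS : y ∈ S := show 2 * M < ‖y‖ by linarith
        rw [indicator_of_mem hyS]
        have h2 := hstat R Φ (E4.ofTimeSpace (u + F y) y) hR (by rwa [E4.spatialNorm_ofTimeSpace])
        refine (mul_le_of_le_one_left (abs_nonneg _) (Real.smoothTransition.le_one _)).trans
          (h2.trans_eq ?_)
        rw [hLrad]
  -- ### the weight is removed (`ε → 0`) and the static layer is killed (`R → ∞`)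
  have hslab : ∀ n : ℕ, ∫⁻ u in Ioc (0 : ℝ) n, ∫⁻ y in {y : E3 | 2 * M < ‖y‖ ∧ ‖y‖ ≤ n},
      ENNReal.ofReal (B (E4.ofTimeSpace (u + F y) y)) ≤ ENNReal.ofReal (2 * ((Kf + 1) * Λ.toReal)) := by
    intro n
    have hA : ∀ m : ℕ, ∫⁻ u in Ioc (0 : ℝ) n, ∫⁻ y in {y : E3 | 2 * M < ‖y‖ ∧ ‖y‖ ≤ n},
        ENNReal.ofReal (B (E4.ofTimeSpace (u + F y) y)) ≤ ENNReal.ofReal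
          (2 * ((Kf + 1) * Λ.toReal) + n * (KR / (16 * M + n + m) * Λ.toReal)) := by
      intro m
      have h16 : 16 * M ≤ 16 * M + n + m := by linarith [n.cast_nonneg (α := ℝ), m.cast_nonneg (α := ℝ)]
      have hpos : 0 < 16 * M + n + m := lt_of_lt_of_le (by positivity) h16
      have hsub : {y : E3 | 2 * M < ‖y‖ ∧ ‖y‖ ≤ n} ⊆ {y : E3 | 2 * M < ‖y‖ ∧ ‖y‖ ≤ 16 * M + n + m} :=
        fun y hy ↦ ⟨hy.1, hy.2.trans (by linarith [m.cast_nonneg (α := ℝ)])⟩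
      refine le_trans (lintegral_mono fun u ↦ lintegral_mono_set hsub) ?_
      exact slab_lintegral_le_of_weighted_le M (16 * M + n + m) F B (n : ℝ)
        (2 * ((Kf + 1) * Λ.toReal) + n * (KR / (16 * M + n + m) * Λ.toReal)) hM hpos hF.continuous
        n.cast_nonneg (fun x hx ↦ And.intro
          (continuousAt_morawetzBulk hM hΦ (lt_trans (by positivity) hx)) (degILED_bulk_nonneg hM Φ hx))
        (fun ε hε hεT ↦ hmain n (16 * M + n + m) n.cast_nonneg h16 ε hε hεT)
    have hlim : Tendsto (fun m : ℕ ↦ ENNReal.ofReal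
        (2 * ((Kf + 1) * Λ.toReal) + n * (KR / (16 * M + n + m) * Λ.toReal))) atTop
        (𝓝 (ENNReal.ofReal (2 * ((Kf + 1) * Λ.toReal)))) := by
      refine (ENNReal.continuous_ofReal.tendsto _).comp ?_
      have h : Tendsto (fun m : ℕ ↦ KR / (16 * M + n + (m : ℝ))) atTop (𝓝 0) :=
        tendsto_const_nhds.div_atTop (tendsto_atTop_add_const_left _ _ tendsto_natCast_atTop_atTop)
      simpa using ((h.mul_const Λ.toReal).const_mul (n : ℝ)).const_add (2 * ((Kf + 1) * Λ.toReal))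
    exact ge_of_tendsto' hlim hA
  -- ### exhaustion `s → ∞` and the constant
  have hfin := degILED_exhaustion M F B _ hM hF.continuous
    (fun x hx ↦ continuousAt_morawetzBulk hM hΦ hx) hslab
  refine hfin.trans (le_of_eq ?_)
  rw [← mul_assoc 2, ENNReal.ofReal_mul (by positivity), ENNReal.ofReal_toReal hΛtop, hΛ]
  ring

end Summit.FinalStateConjecture.FinalStateConjecture.Theorems
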